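import Summits.BirchSwinnertonDyer.BirchSwinnertonDyer.Theorems.KimAtThreeShallowEqDeepSplitGlueNoStub
import Summits.BirchSwinnertonDyer.BirchSwinnertonDyer.Theorems.KimAtThreeDeepLowerSplitGlueItem
import Summits.BirchSwinnertonDyer.BirchSwinnertonDyer.Theorems.KimAtThreeShallowEqDeepOffStratumSockets
import HarnessLib

/-!
# Route `KimAtThreeKolyvagin` (rung W2): the LEAF `N11.KimAtThreeRankZeroPUB` from exactly THREE named
# inputs — the five-part alias `KatoStratumSharedParts` (item 19678), the off-stratum UPPER crux
# `DeepUpperAtThreeOffKatoStratum` (item 19562), and the off-stratum residual (R)_off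

Cell `bsd-addord`, seat `bsd-addord-w2-c4` (gen 6; item of record `stmt-BirchSwinnertonDyer-19077`, owner of
19599). Companion of `KimAtThreeShallowEqDeepOffStratumResidual` (19599 ⟸ 19562 ∧ (R)_off) and
`KimAtThreeShallowEqDeepResidualLeaf` (LEAF ⟸ 19076 ∧ (R)_all). Notation at a row: `a = ∂⁽⁰⁾(δ̃)`,
`s = ord₃ #Ш(E/ℚ)(3)`, `d = ∂^{(∞)}_{deep}(δ̃)`, `∂ = ∂^{(∞)}(δ̃)` (all cyclic levels). The residual (R) at a
row is `a ≤ s + ∂` («`3^{a−s}` divides every cyclic-level Kurihara number»; Kim AJM 148 Thm. 1.9 (6),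
LOWER-BOUND half, at `p = 3` — not in print at `3`); (R)_off = (R) under the binders of crux 19599
(optimal datum at the conductor, `E(ℚ₃)[3] = 0`, row NOT on the Kato stratum); (R)_opt = the same on ALL
optimal-datum rows; (R)_all = (R) under the LEAF's binders (`(W, f)`, `f` the newform).

* §1 TRANSPORT: (R) is an isogeny-class statement (`residual_conclusion_iff_of_isIsogenous`, kim3's
  `KimAtThreeKolyvaginIsogenyInvariance` lemmas: `∂⁽⁰⁾`, `∂^{(∞)}`, `ord₃ #Ш(3)` are invariant along a
  `ℚ`-isogeny when `E[3]` is irreducible), hence (R)_all ⟸ (R)_opt (`residualAll_of_forall_optimalDatum`,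
  `…_atConductor` granted Carayol) — the pattern of kim3's `…IsogenyCruxes.shallowEqDeepAtTorsionFree_of_forall_optimalDatum`.
* §2 ON THE KATO STRATUM (R) IS ALREADY A THEOREM GRANTED THE SHARED PARTS: `residual_optimal_onStratum_of_parts`
  (Sakamoto ×2, GZK, Poitou–Tate, PORT″ ⟹ at an on-stratum optimal row both the LOWER row — kim3's
  `deepLower_optimal_of_ports_of_poitouTate` — and the SHALLOW = DEEP row — w2-c4 g4's
  `shallowEqDeep_conclusion_classwide_noStub` — hence `a ≤ s + d ≤ s + ∂`); so (R)_opt ⟸ parts ∧ (R)_off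
  (`residualOpt_of_parts_of_residualOff`) and (R)_all ⟸ `KatoStratumSharedParts` ∧ (R)_off
  (`residualAll_of_sharedParts_of_residualOff`).
* §3 THE SEAM: **`kimAtThreeRankZeroPUB_of_sharedParts_of_deepUpperOff_of_residualOff :
  KatoStratumSharedParts → DeepUpperAtThreeOffKatoStratum → (R)_off → N11.KimAtThreeRankZeroPUB`** — the
  route's LEAF from the alias item 19678 (Sakamoto ×2, GZK, Poitou–Tate, Carayol = published inputs BY NAME;
  PORT″ = crux 19560), the crux 19562, and ONE displayed residual. Reading for the planner: W2 = {19678,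
  19562, (R)_off}; the cruxes 19075 / 19077 / 19679 / 19599 and the stub child 19561 are not on this seam.

HONEST FRAMING. Theorems only (transport + `ℕ∞` bookkeeping + composition of landed theorems); every
published input, PORT″, crux and (R) is a displayed hypothesis BY NAME or verbatim; nothing asserted about
any curve; nothing booked; 19560, 19562, 19077, 19599 stay OPEN and the leaf is NOT proved; BSD is not
proved by any of this.

References: [Kim2022StructureSelmer] Thm. 1.9 (6), §1.5.1; [Kim2025RefinedTNC] Thm. 1.1; [MazurRubin2004]
Thm. 5.2.12 (i); [Sakamoto2024] Thm. 4.4; [EdixhovenManin1991] Prop. 2; [Carayol1986].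
-/

set_option autoImplicit false
-- the Theorems namespace of a single-conjunct summit repeats the summit name by design (D-0017)
set_option linter.dupNamespace false

noncomputable section

namespace Summit.BirchSwinnertonDyer.BirchSwinnertonDyer.Theorems.KimAtThreeShallowEqDeepResidualSeam

open scoped Classical NumberField
open Function IsDedekindDomain NumberField WeierstrassCurve CongruenceSubgroup
  Literature.NumberTheory.EllipticCurves Literature.NumberTheory.EllipticCurves.ModularForms
  Literature.NumberTheory.EllipticCurves.Rank1Residual
  Literature.NumberTheory.GaloisCohomology
  Summit.BirchSwinnertonDyer.Rank1Residual.GaloisImage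
  Summit.BirchSwinnertonDyer.Rank1Residual.Additive
  Summit.BirchSwinnertonDyer.BirchSwinnertonDyer.Theses.KimAtThreeKolyvagin
  Summit.BirchSwinnertonDyer.BirchSwinnertonDyer.Theorems
  Summit.BirchSwinnertonDyer.BirchSwinnertonDyer.Theorems.KimAtThreeDeepLowerKatoStratumOfFacts
  Summit.BirchSwinnertonDyer.BirchSwinnertonDyer.Theorems.KimAtThreeShallowEqDeepNoStubCruxes
  Summit.BirchSwinnertonDyer.BirchSwinnertonDyer.Theorems.KimAtThreeShallowEqDeepSplitGlueNoStub
  Summit.BirchSwinnertonDyer.BirchSwinnertonDyer.Theorems.KimAtThreeKolyvaginIsogenyInvariance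
  Summit.BirchSwinnertonDyer.BirchSwinnertonDyer.Theorems.KimAtThreeKolyvaginIsogenyTransport
  Summit.BirchSwinnertonDyer.BirchSwinnertonDyer.Theorems.KimAtThreeKolyvaginIsogenyCruxes
  Summit.BirchSwinnertonDyer.BirchSwinnertonDyer.Theorems.KimAtThreeKolyvaginUnitLevelOneRungs
  Summit.BirchSwinnertonDyer.BirchSwinnertonDyer.Theorems.KimAtThreeKolyvaginCertificateDictionary
  Summit.BirchSwinnertonDyer.BirchSwinnertonDyer.Theorems.KimAtThreeShallowEqDeepOffStratumSockets
  Summit.BirchSwinnertonDyer.BirchSwinnertonDyer.Theorems.KimAtThreeDeepLowerSplitGlueItem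

/-! ### §1 Transport: (R) is an isogeny-class statement; (R)_all ⟸ (R)_opt -/

section Transport

variable {W W' : WeierstrassCurve ℚ} [W.IsElliptic] [W'.IsElliptic] [W.IsGloballyMinimal]
  [W'.IsGloballyMinimal] {p : ℕ} [Fact p.Prime] {N : ℕ} (f : CuspForm (Gamma0 N) 2)
  (hiso : IsIsogenous W W') (hirr : W.HasIrreducibleModPGaloisRep p)

include hiso hirr

/-- The row conclusion of (R) (`∂⁽⁰⁾ ≤ ord_p #Ш(p) + ∂^{(∞)}`, any prime `p`, any cusp form `f`) holds for
`W` iff for a `ℚ`-isogenous `W'`, when `E[p]` is irreducible (kim3's invariance lemmas for `∂⁽⁰⁾`,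
`∂^{(∞)}`, `#Ш(p)`). [cite: SilvermanAEC2009, Cor. III.4.11 and Cor. VII.7.2] -/
theorem residual_conclusion_iff_of_isIsogenous :
    kuriharaPartial W p f 0 ≤
        (padicValNat p (Nat.card (AddCommGroup.primaryComponent W.sha p)) : ℕ∞) +
          kuriharaPartialInfty W p f ↔
      kuriharaPartial W' p f 0 ≤
        (padicValNat p (Nat.card (AddCommGroup.primaryComponent W'.sha p)) : ℕ∞) +
          kuriharaPartialInfty W' p f := by
  rw [kuriharaPartial_eq_of_isIsogenous f hiso hirr 0, kuriharaPartialInfty_eq_of_isIsogenous f hiso hirr,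
    natCard_primaryComponent_sha_eq_of_isIsogenous hiso hirr]

end Transport

/-- **(R)_all ⟸ (R) on OPTIMAL parametrised curves** (any level): transport along the prime-to-`3`
isogeny `W ~ W₀` to the lattice-optimal degree-minimal datum of the class (kim3's
`exists_optimalDatum_of_isNewformOf`; the binder `#E(ℚ₃)[3] = 1` moves by
`natCard_torsion_padic_eq_of_isIsogenous`). [cite: EdixhovenManin1991, Prop. 2] [cite: Kim2025RefinedTNC, Thm. 1.1] -/
theorem residualAll_of_forall_optimalDatum
    (h : ∀ (W₀ : WeierstrassCurve ℚ) [W₀.IsElliptic] [W₀.IsGloballyMinimal],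
      (∀ n : ℕ, W₀.HasSurjectiveModNGaloisRep (3 ^ n : ℕ)) →
      Nat.card {Q : (W₀.baseChange ℚ_[3]).toAffine.Point // (3 : ℕ) • Q = 0} = 1 → Finite W₀.sha →
      ∀ {N : ℕ} [NeZero N] (D₀ : ModularParametrizationData W₀ N),
        (∀ z ∈ D₀.L.lattice, ∃ w ∈ periodLattice D₀.f, z = D₀.c * w) →
        (∀ (W₂ : WeierstrassCurve ℚ) [W₂.IsElliptic] (D₂ : ModularParametrizationData W₂ N),
          D₂.f = D₀.f → D₀.modularDegree ≤ D₂.modularDegree) →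
        (∀ r : ℚ, ratPlusSymbol D₀.f r ≠ 0 → 0 ≤ padicValRat 3 (ratPlusSymbol D₀.f r)) →
        kuriharaVanishingOrder W₀ 3 D₀.f = 0 →
        kuriharaPartial W₀ 3 D₀.f 0 ≤
          (padicValNat 3 (Nat.card (AddCommGroup.primaryComponent W₀.sha 3)) : ℕ∞) +
            kuriharaPartialInfty W₀ 3 D₀.f) :
    ∀ (W : WeierstrassCurve ℚ) [W.IsElliptic] [W.IsGloballyMinimal],
        (∀ n : ℕ, W.HasSurjectiveModNGaloisRep (3 ^ n : ℕ)) →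
        Nat.card {Q : (W.baseChange ℚ_[3]).toAffine.Point // (3 : ℕ) • Q = 0} = 1 →
        Finite W.sha →
        ∀ {N : ℕ} [NeZero N] (f : CuspForm (Gamma0 N) 2), IsNewformOf W f →
        (∀ r : ℚ, ratPlusSymbol f r ≠ 0 → 0 ≤ padicValRat 3 (ratPlusSymbol f r)) →
        kuriharaVanishingOrder W 3 f = 0 →
          kuriharaPartial W 3 f 0 ≤
            (padicValNat 3 (Nat.card (AddCommGroup.primaryComponent W.sha 3)) : ℕ∞) +
              kuriharaPartialInfty W 3 f := by
  intro W _ _ htow ht0 hfin N _ f hf hint hord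
  haveI : Fact (Nat.Prime 3) := ⟨Nat.prime_three⟩
  have hirr : W.HasIrreducibleModPGaloisRep 3 := hasIrreducibleModPGaloisRep_of_tower htow
  obtain ⟨W₀, hW₀, hW₀', D₀, hf₀, hiso, hopt, hdeg⟩ := exists_optimalDatum_of_isNewformOf hf
  have ht0₀ : Nat.card {Q : (W₀.baseChange ℚ_[3]).toAffine.Point // (3 : ℕ) • Q = 0} = 1 := by
    rw [← natCard_torsion_padic_eq_of_isIsogenous hiso hirr]
    exact ht0
  have h₀ := h W₀ (towerSurjective_of_isIsogenous hiso htow) ht0₀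
    ((finite_sha_iff_of_isIsogenous hiso).mp hfin) D₀ hopt hdeg (by rw [hf₀]; exact hint)
    (by rw [hf₀, ← kuriharaVanishingOrder_eq_of_isIsogenous f hiso hirr]; exact hord)
  rw [hf₀] at h₀
  exact (residual_conclusion_iff_of_isIsogenous f hiso hirr).mpr h₀

/-- **(R)_all ⟸ (R)_opt — optimal data AT THE CONDUCTOR, granted Carayol** (`hlev`, the tree's named fact
`IsNewformOf.level_eq_conductorNorm`, conjunct 4 of `KatoStratumSharedParts`). [cite: Carayol1986]
[cite: Kim2025RefinedTNC, Thm. 1.1] -/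
theorem residualAll_of_forall_optimalDatum_atConductor
    (hlev : ∀ (N : ℕ) [NeZero N], IsNewformOf.level_eq_conductorNorm (N := N))
    (h : ∀ (W₀ : WeierstrassCurve ℚ) [W₀.IsElliptic] [W₀.IsGloballyMinimal],
      (∀ n : ℕ, W₀.HasSurjectiveModNGaloisRep (3 ^ n : ℕ)) →
      Nat.card {Q : (W₀.baseChange ℚ_[3]).toAffine.Point // (3 : ℕ) • Q = 0} = 1 → Finite W₀.sha →
      ∀ {N : ℕ} [NeZero N], N = W₀.conductorNorm ℤ → ∀ (D₀ : ModularParametrizationData W₀ N),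
        (∀ z ∈ D₀.L.lattice, ∃ w ∈ periodLattice D₀.f, z = D₀.c * w) →
        (∀ (W₂ : WeierstrassCurve ℚ) [W₂.IsElliptic] (D₂ : ModularParametrizationData W₂ N),
          D₂.f = D₀.f → D₀.modularDegree ≤ D₂.modularDegree) →
        (∀ r : ℚ, ratPlusSymbol D₀.f r ≠ 0 → 0 ≤ padicValRat 3 (ratPlusSymbol D₀.f r)) →
        kuriharaVanishingOrder W₀ 3 D₀.f = 0 →
        kuriharaPartial W₀ 3 D₀.f 0 ≤
          (padicValNat 3 (Nat.card (AddCommGroup.primaryComponent W₀.sha 3)) : ℕ∞) +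
            kuriharaPartialInfty W₀ 3 D₀.f) :
    ∀ (W : WeierstrassCurve ℚ) [W.IsElliptic] [W.IsGloballyMinimal],
        (∀ n : ℕ, W.HasSurjectiveModNGaloisRep (3 ^ n : ℕ)) →
        Nat.card {Q : (W.baseChange ℚ_[3]).toAffine.Point // (3 : ℕ) • Q = 0} = 1 →
        Finite W.sha →
        ∀ {N : ℕ} [NeZero N] (f : CuspForm (Gamma0 N) 2), IsNewformOf W f →
        (∀ r : ℚ, ratPlusSymbol f r ≠ 0 → 0 ≤ padicValRat 3 (ratPlusSymbol f r)) →
        kuriharaVanishingOrder W 3 f = 0 →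
          kuriharaPartial W 3 f 0 ≤
            (padicValNat 3 (Nat.card (AddCommGroup.primaryComponent W.sha 3)) : ℕ∞) +
              kuriharaPartialInfty W 3 f :=
  residualAll_of_forall_optimalDatum fun W₀ _ _ htow ht0 hfin _ _ D₀ hopt hdeg hint hord =>
    h W₀ htow ht0 hfin (hlev _ D₀.isNewformOf) D₀ hopt hdeg hint hord

/-! ### §2 On the Kato stratum (R) is a theorem granted the shared parts -/

/-- **(R) at an ON-STRATUM optimal row, GRANTED the shared parts** (Sakamoto ×2, GZK, Poitou–Tate by name
and the PORT″ witness at the row): the LOWER row `a ≤ s + d` is kim3's `deepLower_optimal_of_ports_of_poitouTate`,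
the SHALLOW = DEEP row `d ≤ ∂` is w2-c4 g4's `shallowEqDeep_conclusion_classwide_noStub` (read at `W = W₀`),
and `a ≤ s + d ≤ s + ∂`. [cite: Sakamoto2024, Thm. 4.4 (p. 926)] [cite: MazurRubin2004, Thm. 5.2.12 (i)]
[cite: Kim2022StructureSelmer, Thm. 3.13 and Thm. 1.9 (6)] -/
theorem residual_optimal_onStratum_of_parts
    (hS24 : Sakamoto2024.kolyvaginSystems_freeRankOne_zmod_three_pow)
    (hS24₂ : Sakamoto2024.kolyvaginSystems_idealOfBasis_eq_fittingIdeal_zmod_three_pow)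
    (hGZK : rank_eq_analyticRank_of_analyticRank_le_one)
    (hPT : poitouTate_selmerStructure_duality ℚ)
    (W₀ : WeierstrassCurve ℚ) [W₀.IsElliptic] [W₀.IsGloballyMinimal]
    (hadd : haveI : Fact (Nat.Prime 3) := ⟨Nat.prime_three⟩; Addv W₀ 3)
    (hc3 : ¬ 3 ∣ (W₀.baseChange ℚ_[3]).localTamagawaNumber ℤ_[3])
    (htow : ∀ m : ℕ, W₀.HasSurjectiveModNGaloisRep (3 ^ m : ℕ))
    (ht0 : Nat.card {Q : (W₀.baseChange ℚ_[3]).toAffine.Point // (3 : ℕ) • Q = 0} = 1)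
    {N : ℕ} [NeZero N] (hN : N = W₀.conductorNorm ℤ) (D₀ : ModularParametrizationData W₀ N)
    (hopt : ∀ z ∈ D₀.L.lattice, ∃ w ∈ periodLattice D₀.f, z = D₀.c * w)
    (hcD : ¬ (3 : ℤ) ∣ D₀.maninConstant)
    (hint : ∀ r : ℚ, ratPlusSymbol D₀.f r ≠ 0 → 0 ≤ padicValRat 3 (ratPlusSymbol D₀.f r))
    (v₃ : HeightOneSpectrum (𝓞 ℚ)) (hv₃ : ((3 : ℕ) : 𝓞 ℚ) ∈ v₃.asIdeal)
    (η : (q : HeightOneSpectrum (𝓞 ℚ)) → (ZMod (Ideal.absNorm q.asIdeal))ˣ)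
    (hη : ∀ q : HeightOneSpectrum (𝓞 ℚ), Subgroup.zpowers (η q) = ⊤)
    (hPort : KatoKuriharaPortThreeAtWith₂ W₀ 0 v₃ η D₀)
    (hord : kuriharaVanishingOrder W₀ 3 D₀.f = 0) :
    kuriharaPartial W₀ 3 D₀.f 0 ≤
      (padicValNat 3 (Nat.card (AddCommGroup.primaryComponent W₀.sha 3)) : ℕ∞) +
        kuriharaPartialInfty W₀ 3 D₀.f :=
  le_add_partialInfty_of_lowerRow_of_shallowEqDeep_conclusion W₀ 3 D₀.f
    (deepLower_optimal_of_ports_of_poitouTate hS24 hS24₂ hGZK hPT W₀ hadd hc3 htow ht0 hN D₀ hopt hcD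
      v₃ hv₃ η hη hPort hord)
    (shallowEqDeep_conclusion_classwide_noStub hS24 hS24₂ hGZK hPT W₀ W₀ (IsIsogenous.refl_holds W₀)
      hadd htow ht0 hc3 hN D₀ hopt hcD hint v₃ hv₃ η hη hPort hord)

/-- **(R)_opt (every optimal-datum row at the conductor) ⟸ the four published parts ∧ PORT″ (crux 19560)
∧ (R)_off**: case split on the Kato stratum. [cite: Kim2025RefinedTNC, Thm. 1.1] [cite: Sakamoto2024, Thm. 4.4 (p. 926)] -/
theorem residualOpt_of_parts_of_residualOff (hSak : SakamotoKolyvaginThree)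
    (hGZK : RankEqAnalyticRankLeOne) (hPT : PoitouTateSelmerDuality) (hPort : KatoKuriharaPortThreeShared)
    (hRoff : ∀ (W₀ : WeierstrassCurve ℚ) [W₀.IsElliptic] [W₀.IsGloballyMinimal],
      (∀ n : ℕ, W₀.HasSurjectiveModNGaloisRep (3 ^ n : ℕ)) →
      Nat.card {Q : (W₀.baseChange ℚ_[3]).toAffine.Point // (3 : ℕ) • Q = 0} = 1 → Finite W₀.sha →
      ∀ {N : ℕ} [NeZero N], N = W₀.conductorNorm ℤ →
      ∀ (D₀ : ModularParametrizationData W₀ N),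
        (∀ z ∈ D₀.L.lattice, ∃ w ∈ periodLattice D₀.f, z = D₀.c * w) →
        (∀ (W₂ : WeierstrassCurve ℚ) [W₂.IsElliptic] (D₂ : ModularParametrizationData W₂ N),
          D₂.f = D₀.f → D₀.modularDegree ≤ D₂.modularDegree) →
        (∀ r : ℚ, ratPlusSymbol D₀.f r ≠ 0 → 0 ≤ padicValRat 3 (ratPlusSymbol D₀.f r)) →
        kuriharaVanishingOrder W₀ 3 D₀.f = 0 →
        ¬ ((haveI : Fact (Nat.Prime 3) := ⟨Nat.prime_three⟩; Addv W₀ 3) ∧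
            ¬ 3 ∣ (W₀.baseChange ℚ_[3]).localTamagawaNumber ℤ_[3] ∧ ¬ (3 : ℤ) ∣ D₀.maninConstant) →
        kuriharaPartial W₀ 3 D₀.f 0 ≤
          (padicValNat 3 (Nat.card (AddCommGroup.primaryComponent W₀.sha 3)) : ℕ∞) +
            kuriharaPartialInfty W₀ 3 D₀.f) :
    ∀ (W₀ : WeierstrassCurve ℚ) [W₀.IsElliptic] [W₀.IsGloballyMinimal],
      (∀ n : ℕ, W₀.HasSurjectiveModNGaloisRep (3 ^ n : ℕ)) →
      Nat.card {Q : (W₀.baseChange ℚ_[3]).toAffine.Point // (3 : ℕ) • Q = 0} = 1 → Finite W₀.sha →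
      ∀ {N : ℕ} [NeZero N], N = W₀.conductorNorm ℤ → ∀ (D₀ : ModularParametrizationData W₀ N),
        (∀ z ∈ D₀.L.lattice, ∃ w ∈ periodLattice D₀.f, z = D₀.c * w) →
        (∀ (W₂ : WeierstrassCurve ℚ) [W₂.IsElliptic] (D₂ : ModularParametrizationData W₂ N),
          D₂.f = D₀.f → D₀.modularDegree ≤ D₂.modularDegree) →
        (∀ r : ℚ, ratPlusSymbol D₀.f r ≠ 0 → 0 ≤ padicValRat 3 (ratPlusSymbol D₀.f r)) →
        kuriharaVanishingOrder W₀ 3 D₀.f = 0 →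
        kuriharaPartial W₀ 3 D₀.f 0 ≤
          (padicValNat 3 (Nat.card (AddCommGroup.primaryComponent W₀.sha 3)) : ℕ∞) +
            kuriharaPartialInfty W₀ 3 D₀.f := by
  intro W₀ _ _ htow ht0 hfin N _ hN D₀ hopt hdeg hint hord
  by_cases hroad :
      ((haveI : Fact (Nat.Prime 3) := ⟨Nat.prime_three⟩; Addv W₀ 3) ∧
        ¬ 3 ∣ (W₀.baseChange ℚ_[3]).localTamagawaNumber ℤ_[3] ∧
        ¬ (3 : ℤ) ∣ D₀.maninConstant)
  · obtain ⟨hadd, hc3, hcD⟩ := hroad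
    obtain ⟨v₃, η, hv₃, hη⟩ := exists_place_three_and_generators
    exact residual_optimal_onStratum_of_parts hSak.1 hSak.2 hGZK hPT W₀ hadd hc3 htow ht0 hN D₀ hopt hcD
      hint v₃ hv₃ η hη (hPort W₀ htow hadd hc3 ht0 v₃ hv₃ η hη D₀ hN hopt hcD) hord
  · exact hRoff W₀ htow ht0 hfin hN D₀ hopt hdeg hint hord hroad

/-- **(R)_all ⟸ `KatoStratumSharedParts` (alias item 19678) ∧ (R)_off.** [cite: Kim2025RefinedTNC, Thm. 1.1]
[cite: Carayol1986] -/
theorem residualAll_of_sharedParts_of_residualOff (hParts : KatoStratumSharedParts)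
    (hRoff : ∀ (W₀ : WeierstrassCurve ℚ) [W₀.IsElliptic] [W₀.IsGloballyMinimal],
      (∀ n : ℕ, W₀.HasSurjectiveModNGaloisRep (3 ^ n : ℕ)) →
      Nat.card {Q : (W₀.baseChange ℚ_[3]).toAffine.Point // (3 : ℕ) • Q = 0} = 1 → Finite W₀.sha →
      ∀ {N : ℕ} [NeZero N], N = W₀.conductorNorm ℤ →
      ∀ (D₀ : ModularParametrizationData W₀ N),
        (∀ z ∈ D₀.L.lattice, ∃ w ∈ periodLattice D₀.f, z = D₀.c * w) →
        (∀ (W₂ : WeierstrassCurve ℚ) [W₂.IsElliptic] (D₂ : ModularParametrizationData W₂ N),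
          D₂.f = D₀.f → D₀.modularDegree ≤ D₂.modularDegree) →
        (∀ r : ℚ, ratPlusSymbol D₀.f r ≠ 0 → 0 ≤ padicValRat 3 (ratPlusSymbol D₀.f r)) →
        kuriharaVanishingOrder W₀ 3 D₀.f = 0 →
        ¬ ((haveI : Fact (Nat.Prime 3) := ⟨Nat.prime_three⟩; Addv W₀ 3) ∧
            ¬ 3 ∣ (W₀.baseChange ℚ_[3]).localTamagawaNumber ℤ_[3] ∧ ¬ (3 : ℤ) ∣ D₀.maninConstant) →
        kuriharaPartial W₀ 3 D₀.f 0 ≤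
          (padicValNat 3 (Nat.card (AddCommGroup.primaryComponent W₀.sha 3)) : ℕ∞) +
            kuriharaPartialInfty W₀ 3 D₀.f) :
    ∀ (W : WeierstrassCurve ℚ) [W.IsElliptic] [W.IsGloballyMinimal],
        (∀ n : ℕ, W.HasSurjectiveModNGaloisRep (3 ^ n : ℕ)) →
        Nat.card {Q : (W.baseChange ℚ_[3]).toAffine.Point // (3 : ℕ) • Q = 0} = 1 →
        Finite W.sha →
        ∀ {N : ℕ} [NeZero N] (f : CuspForm (Gamma0 N) 2), IsNewformOf W f →
        (∀ r : ℚ, ratPlusSymbol f r ≠ 0 → 0 ≤ padicValRat 3 (ratPlusSymbol f r)) →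
        kuriharaVanishingOrder W 3 f = 0 →
          kuriharaPartial W 3 f 0 ≤
            (padicValNat 3 (Nat.card (AddCommGroup.primaryComponent W.sha 3)) : ℕ∞) +
              kuriharaPartialInfty W 3 f := by
  obtain ⟨hSak, hGZK, hPT, hlev, hPort⟩ := hParts
  exact residualAll_of_forall_optimalDatum_atConductor hlev
    (residualOpt_of_parts_of_residualOff hSak hGZK hPT hPort hRoff)

/-! ### §3 The seam: the LEAF from 19678, 19562 and (R)_off -/

/-- **The route's LEAF `N11.KimAtThreeRankZeroPUB` ⟸ `KatoStratumSharedParts` (alias item 19678: Sakamoto ×2,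
GZK, Poitou–Tate, Carayol by name; PORT″ = crux 19560) ∧ crux 19562 `DeepUpperAtThreeOffKatoStratum` ∧ the
displayed residual (R)_off.** Composition: `DeepUpperAtThree` (19076) from the parts and 19562 (w2-c2 g4 /
w2-c4 g4 `deepUpperAtThree_of_katoStratumSharedParts`); (R)_all from the parts and (R)_off (§2); at a row of
the leaf `s + d ≤ a ≤ s + ∂ ≤ s + d` forces `a = s + d` and `∂ = d` (= `KimAtThreeShallowEqDeepResidualLeaf.kimAtThreeRankZeroPUB_of_upper_of_residual`,
re-derived here). Neither 19075, 19077, 19679, 19599 nor the stub child 19561 is an input.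
[cite: Kim2025RefinedTNC, Thm. 1.1] [cite: Kim2022StructureSelmer, Thm. 1.9 (6)] [cite: MazurRubin2004, Thm. 5.2.12 (i)]
[cite: Sakamoto2024, Thm. 4.4 (p. 926)] -/
theorem kimAtThreeRankZeroPUB_of_sharedParts_of_deepUpperOff_of_residualOff
    (hParts : KatoStratumSharedParts) (hU : DeepUpperAtThreeOffKatoStratum)
    (hRoff : ∀ (W₀ : WeierstrassCurve ℚ) [W₀.IsElliptic] [W₀.IsGloballyMinimal],
      (∀ n : ℕ, W₀.HasSurjectiveModNGaloisRep (3 ^ n : ℕ)) →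
      Nat.card {Q : (W₀.baseChange ℚ_[3]).toAffine.Point // (3 : ℕ) • Q = 0} = 1 → Finite W₀.sha →
      ∀ {N : ℕ} [NeZero N], N = W₀.conductorNorm ℤ →
      ∀ (D₀ : ModularParametrizationData W₀ N),
        (∀ z ∈ D₀.L.lattice, ∃ w ∈ periodLattice D₀.f, z = D₀.c * w) →
        (∀ (W₂ : WeierstrassCurve ℚ) [W₂.IsElliptic] (D₂ : ModularParametrizationData W₂ N),
          D₂.f = D₀.f → D₀.modularDegree ≤ D₂.modularDegree) →
        (∀ r : ℚ, ratPlusSymbol D₀.f r ≠ 0 → 0 ≤ padicValRat 3 (ratPlusSymbol D₀.f r)) →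
        kuriharaVanishingOrder W₀ 3 D₀.f = 0 →
        ¬ ((haveI : Fact (Nat.Prime 3) := ⟨Nat.prime_three⟩; Addv W₀ 3) ∧
            ¬ 3 ∣ (W₀.baseChange ℚ_[3]).localTamagawaNumber ℤ_[3] ∧ ¬ (3 : ℤ) ∣ D₀.maninConstant) →
        kuriharaPartial W₀ 3 D₀.f 0 ≤
          (padicValNat 3 (Nat.card (AddCommGroup.primaryComponent W₀.sha 3)) : ℕ∞) +
            kuriharaPartialInfty W₀ 3 D₀.f) :
    N11.KimAtThreeRankZeroPUB := by
  have hUpper : DeepUpperAtThree := deepUpperAtThree_of_katoStratumSharedParts hParts hU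
  have hR := residualAll_of_sharedParts_of_residualOff hParts hRoff
  intro W _ _ htower ht0 hfin N _ f hf hint hord
  obtain ⟨d, hd, hge⟩ := hUpper W htower hfin f hf hint hord
  have hle := hR W htower ht0 hfin f hf hint hord
  set s := padicValNat 3 (Nat.card (AddCommGroup.primaryComponent W.sha 3)) with hs
  have hpd : kuriharaPartialInfty W 3 f ≤ (d : ℕ∞) := by
    rw [← hd]
    exact kuriharaPartialInfty_le_kuriharaPartialDeepInfty W 3 f
  have hptop : kuriharaPartialInfty W 3 f ≠ ⊤ := ne_top_of_le_ne_top (ENat.coe_ne_top d) hpd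
  obtain ⟨j, hj⟩ : ∃ j : ℕ, kuriharaPartialInfty W 3 f = j :=
    (ENat.ne_top_iff_exists.mp hptop).imp fun j h => h.symm
  have hjd : j ≤ d := by
    rw [hj] at hpd
    exact_mod_cast hpd
  have hchain : ((s + d : ℕ) : ℕ∞) ≤ (s : ℕ∞) + (j : ℕ∞) := by
    rw [← hj]
    exact hge.trans hle
  have hdj : d ≤ j := by
    have : s + d ≤ s + j := by exact_mod_cast hchain
    omega
  have hjd' : j = d := le_antisymm hjd hdj
  refine ⟨d, ?_, le_antisymm ?_ hge⟩
  · rw [hj, hjd']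
  · calc kuriharaPartial W 3 f 0 ≤ (s : ℕ∞) + kuriharaPartialInfty W 3 f := hle
      _ = ((s + d : ℕ) : ℕ∞) := by rw [hj, hjd', Nat.cast_add]

end Summit.BirchSwinnertonDyer.BirchSwinnertonDyer.Theorems.KimAtThreeShallowEqDeepResidualSeam

end
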